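import Mathlib
import Summits.Ventures.PercRepro.TriangleCapTwoBelowSecondBest

/-!
# PercRepro — THE DIAMOND-FREE EXTREMAL GRAPHS ARE THE BALANCED COMPLETE BIPARTITE GRAPHS: for `k ≥ 7`, every
`K₄⁻`-free graph on `k` vertices with `⌊k/2⌋ · ⌈k/2⌉ = ⌊k²/4⌋` edges is a spanning subgraph of `K(A, Aᶜ)` with
`|A| = ⌊k/2⌋`, hence equal to `K_{⌊k/2⌋,⌈k/2⌉}` (p3, gen 44; part 196e)

A by-product of the cap lemma: with `a = ⌊k/2⌋` and `m = a (k − a)`, the degree sum `2m` exceeds `(k − a − 1) k`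
(`k = 2a`: `2a² > (a − 1) 2a`; `k = 2a + 1`: `2a (a + 1) > a (2a + 1)`), so some vertex has degree `≥ k − a`, which is
the cap of the max-degree lemma (`deg_add_le_card_of_dense`); at the cap `D ⊆ K(N(x)ᶜ, N(x))` (`diag_cap_gen` for
`a ≥ 4`, `three_row_cap` at `r = 0` for `a = 3`, i.e. `k = 7`). The census cells `(9, 20)` and `(11, 30)` (the
copies of `K_{4,5}` and `K_{5,6}`, nothing else) are instances. Axioms: standard.
-/

namespace PercRepro

namespace TriangleCap

namespace C047

open Finset

variable {V : Type*} [Fintype V] [DecidableEq V]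

omit [DecidableEq V] in
/-- Pigeonhole on the degree sum: `2m > c · k` ⇒ some vertex has degree `> c`. -/
theorem exists_deg_gt_of_sum (D : SimpleGraph V) [DecidableRel D.Adj] (c : ℕ)
    (h : Fintype.card V * c < 2 * D.edgeFinset.card) : ∃ v, c < deg D v := by
  by_contra hcon
  push Not at hcon
  have hsum : ∑ v, deg D v ≤ ∑ _v : V, c := sum_le_sum (fun v _ => hcon v)
  rw [sum_deg_eq, sum_const, card_univ, smul_eq_mul] at hsum
  omega

/-- The balanced edge count: `⌊k/2⌋ (k − ⌊k/2⌋) = ⌊k²/4⌋`. -/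
theorem half_mul_eq_sq_div_four (k : ℕ) : (k / 2) * (k - k / 2) = k * k / 4 := by
  obtain ⟨a, rfl | rfl⟩ := Nat.even_or_odd' k
  · rw [show 2 * a / 2 = a by omega, show 2 * a - a = a by omega]
    rw [show 2 * a * (2 * a) = (a * a) * 4 by ring, Nat.mul_div_cancel _ (by norm_num)]
  · rw [show (2 * a + 1) / 2 = a by omega, show 2 * a + 1 - a = a + 1 by omega]
    rw [show (2 * a + 1) * (2 * a + 1) = 4 * (a * (a + 1)) + 1 by ring, Nat.mul_add_div (by norm_num)]
    simp

/-- **THE DIAMOND-FREE EXTREMAL GRAPHS, `k ≥ 7`:** `K₄⁻`-free with `a (k − a)` edges, `a = ⌊k/2⌋` ⇒ `D` is a spanning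
subgraph of `K(A, Aᶜ)` for some `|A| = a` (hence `D = K_{a,k−a}`). -/
theorem k4mFree_extremal_bipSub (D : SimpleGraph V) [DecidableRel D.Adj] (hK : K4mFree D)
    (hk : 7 ≤ Fintype.card V) (hm : D.edgeFinset.card = (Fintype.card V / 2) * (Fintype.card V - Fintype.card V / 2)) :
    ∃ A : Finset V, A.card = Fintype.card V / 2 ∧ BipSub D A := by
  obtain ⟨a, ha⟩ : ∃ a, Fintype.card V / 2 = a := ⟨_, rfl⟩
  rw [ha] at hm ⊢
  have hk2 : 2 * a ≤ Fintype.card V := by omega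
  have ha3 : 3 ≤ a := by omega
  -- a vertex of degree `≥ k − a`
  obtain ⟨x, hx⟩ : ∃ x, Fintype.card V - a - 1 < deg D x := by
    apply exists_deg_gt_of_sum
    rw [hm]
    obtain ⟨c, hc⟩ : ∃ c, Fintype.card V = 2 * a + c := ⟨Fintype.card V - 2 * a, by omega⟩
    have hc1 : c ≤ 1 := by omega
    rw [hc]
    interval_cases c
    · have e1 : 2 * a + 0 - a - 1 = a - 1 := by omega
      have e2 : 2 * a + 0 - a = a := by omega
      rw [e1, e2]
      obtain ⟨a', rfl⟩ : ∃ a', a = a' + 1 := ⟨a - 1, by omega⟩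
      rw [show a' + 1 - 1 = a' by omega]
      nlinarith
    · have e1 : 2 * a + 1 - a - 1 = a := by omega
      have e2 : 2 * a + 1 - a = a + 1 := by omega
      rw [e1, e2]
      nlinarith
  -- the cap: every degree is `≤ k − a`
  have hcap : deg D x + a ≤ Fintype.card V :=
    deg_add_le_card_of_dense D hK a ha3 hk2
      (cap_arith a (Fintype.card V) D.edgeFinset.card 0 (by omega) (by omega)
        (diag_cap_arith a (Fintype.card V) D.edgeFinset.card (by omega) hm)) x
  have hxa : deg D x + a = Fintype.card V := by omega
  rcases Nat.lt_or_ge a 4 with h3 | h4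
  · -- `a = 3`, `k = 7`: the cap lemma of the row `a = 3` at `r = 0`
    obtain rfl : a = 3 := by omega
    have hk7 : Fintype.card V = 7 := by omega
    rcases three_row_cap D hK 0 (by omega) (by omega) x hxa with h | ⟨h1, -⟩
    · exact h
    · omega
  · exact diag_cap_gen D hK a h4 hk2 hm x hxa

/-- **THE DIAMOND-FREE EXTREMAL GRAPHS ARE COMPLETE BIPARTITE BALANCED:** `K₄⁻`-free, `k ≥ 7`, `⌊k²/4⌋` edges ⇒
`∃ A`, `|A| = ⌊k/2⌋`, every pair `x ∈ A`, `y ∉ A` adjacent and no other edge. -/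
theorem k4mFree_extremal_complete (D : SimpleGraph V) [DecidableRel D.Adj] (hK : K4mFree D)
    (hk : 7 ≤ Fintype.card V) (hm : D.edgeFinset.card = Fintype.card V * Fintype.card V / 4) :
    ∃ A : Finset V, A.card = Fintype.card V / 2 ∧ ∀ x y, D.Adj x y ↔ ((x ∈ A ↔ y ∉ A) ∧ x ≠ y) := by
  rw [← half_mul_eq_sq_div_four] at hm
  obtain ⟨A, hA, hB⟩ := k4mFree_extremal_bipSub D hK hk hm
  refine ⟨A, hA, fun x y => ⟨fun h => ⟨hB x y h, D.ne_of_adj h⟩, fun ⟨h1, h2⟩ => ?_⟩⟩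
  by_cases hx : x ∈ A
  · exact adj_of_bipSub_full D A hB _ hA hm hx (h1.mp hx)
  · have hy : y ∈ A := by tauto
    exact D.adj_symm (adj_of_bipSub_full D A hB _ hA hm hy hx)

end C047

end TriangleCap

end PercRepro
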